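import Summits.AtomisticToContinuum.Crystallization.Theses.GscTwinLoopSurgery
import Literature.MathematicalPhysics.StatisticalMechanics.LocalLimitOfGroundStates
import Literature.MathematicalPhysics.StatisticalMechanics.HardCoreGSC

/-!
# Birth skeleton for crux `LayeredWindows` (stmt-AtomisticToContinuum-14083)

Route `GscTwinLoopSurgery`, sub-problem `Crystallization` (file `Cruxes/LayeredWindows/Lines/birth.lean`,
registrar `planner-skel-stmt-AtomisticToContinuum-14083-0`, 2026-08-17).

The crux (`Theses.GscTwinLoopSurgery.LayeredWindows`): every `r₀`-relatively dense hard-core GSC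
`X ∈ 𝔏` (local limit of translated Lennard-Jones ground states) carries, for every `R > 0`, a window
`B(c, R)`, `c ∈ X`, two-way `(1/1000)`-matched with an isometric copy of a uniform Barlow stacking
`barlowStacking a h s`, `(a, h) ∈ B′ = [191/200, 197/200] × [81a/100, 329a/400]`, any Hägg word `s`.

## The cut: local order (physics) / rigidity (geometry) / equation of state (physics)

Write `B = [47/50, 1] × [39a/50, 17a/20] ⊇ B′` for the registry box of the CLOSED item
`LjRegistryDomination` (stmt-3063) and call a point `p ∈ X` **`η`-regular** if `X` is two-way
`η`-matched on the closed ball `B(p, 2)` (two coordination shells) with `A(barlowStacking a h s) + v`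
for some linear isometry `A`, translation `v`, `(a, h) ∈ B` and Hägg word `s` — a purely LOCAL notion of
close-packed order (any stacking letter, any registry; coherent twin planes are NOT defects).

* `stub_sparseIrregular` (S, the LJ physics at infinite volume, open-problem/XL): in every
  `r₀`-dense hard-core GSC `X ∈ 𝔏` the `η`-irregular points have DENSITY ZERO — for every `δ > 0`,
  eventually in `L`, at most `δ L³` of them lie in `‖·‖ ≤ L`.  Content: the coercive crystallization
  inequality for Lennard-Jones in `ℝ³` at the level of local limits (amorphous / polytetrahedral /
  icosahedral order has positive excess energy density) plus GSC surgery (recrystallising a ball: grain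
  boundaries, voids and strain of a canonical GSC meet `o(L³)` sites of `B_L`; conjecturally `O(L²)`).
  This is the route header's foreseen child `LocalBarlow` in its weakest usable form (lim-density `0`,
  centre `0`, constants depending on `X`).  INHERITED COUPLING (not introduced here): the reference
  stackings have ONE interlayer spacing `h`, while relaxed LJ registry walls shift the local spacing by
  `≈ 6.4e-5` (refuter note `LatticeParams.md` on the item); so for `η ≲ 1e-4` wall-adjacent sites are
  irregular and S also asserts density zero of registry walls — the density shadow of `TwinLoopLemma`
  (pairwise loop surgery under the CLOSED `LjRegistryDomination`), exactly as the crux itself tolerates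
  only `≲ 15` uncompensated walls per `(1/1000)`-window.
* `stub_closePackedRigidity` (C, discrete geometry, L): for every `R` there are `R₁ ≥ R` and `η > 0`
  such that a uniformly discrete `X` all of whose points in `B(c, R₁)` (`c ∈ X`) are `η`-regular is
  two-way `(1/2000)`-matched on `B(c, R)` with ONE isometric uniform Barlow stacking with parameters in
  `B`.  Content: exact local-to-global rigidity of locally close-packed sets (coherent twin planes of one
  normal glue into a Hägg word; non-parallel coherent planes meeting `B(c, R)` intersect within
  `R / sin(35.26°) < 2R` of `c`, where the junction is irregular — hence `R₁ ≈ 2R + O(1)`), then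
  `η > 0` by compactness (`LocalMatchingCompactness`).  The local radius `2` is FIXED: with a local radius
  `≥ R` the statement would be trivial.
* `stub_zeroPressureBox` (P, equation of state, L): in an `r₀`-dense hard-core GSC `X ∈ 𝔏`, every
  loose window (box `B`, tolerance `1/2000`) of radius `R₂ = R₂(X, R)` re-matches on the concentric ball
  of radius `R` with parameters in the zero-pressure box `B′` at tolerance `1/1000`.  Content: local
  limits of FREE clusters sustain no bulk strain — persistent lattice parameters of bulk windows are the
  zero-pressure ones `(a*, h*) ≈ (0.9712, 0.7930) ∈ B′` (margins `0.014 / 0.005`, refuter numerics on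
  the item) — by finite-`N` minimality (transport of surplus / deficit matter to the free surface) and the
  certified shape of `e(a, h)` on `B`; re-anchoring by `BarlowStackingWindowRebase`.

The composition `layeredWindows_of_stubs` is a real proof (pigeonhole over a cubic grid of
`m³` disjoint balls of radius `R₁ + r₀` inside `‖·‖ ≤ L`, `L = 3(2R₁ + 2r₀ + 2)m + R₁ + r₀`, against the
`δ L³` bound with `δ = 1 / (128 (2R₁ + 2r₀ + 2)³)`; anchoring the clean ball at a particle by
`r₀`-density; uniform discreteness of `X ∈ 𝔏` from `LennardJonesMinimalDistance_holds`; then C, then P),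
and `LayeredWindows_of` concludes the route decl BY NAME from the three stubs.

BC3 audit (registrar, farm `lean check --json`): rc 0, errors 0, warnings = 3 × "declaration uses
sorry" at the three `stub_*` (sorries 3 = stubs 3, zero elsewhere; `layeredWindows_of_stubs` closed);
probes `stub → LayeredWindows` / `stub → Crystallization` by `first | exact? | simpa | aesop`
(maxHeartbeats 400000) FAIL for all three stubs (granular: `exact?` "could not close the goal", `simpa`
"assumption failed", `aesop` "failed to prove the goal after exhaustive search"; `exact?` against the
sub-statement times out at `whnf`).

Disproof.lean for this crux: none exists yet (`ledger crux ls` 2026-08-17: no workfiles); negatives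
index read: 3506 (multiplicity-blind matching of finite configurations — here `X` is a set and C carries
`UniformlyDiscrete X`) and 4146 (local Hales-type 12-neighbour statement — not used: regularity is
two-way matching with a Barlow piece on a radius-2 ball, tolerance `η → 0`, never a fixed `1/100`).
-/

noncomputable section

namespace Summit.AtomisticToContinuum.Crystallization.Cruxes.LayeredWindows.Birth

open scoped BigOperators
open Filter Set Metric
open Literature.MathematicalPhysics.StatisticalMechanics

/-! ## The three stubs -/

/-- **Stub S — sparse irregularity (local close-packed order of bulk local limits).**  For every local
tolerance `η > 0` and density radius `r₀ > 0`, in every `r₀`-relatively dense hard-core canonical GSC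
`X ∈ 𝔏` (local limit of translated Lennard-Jones ground states) the points `p ∈ X` that are NOT
`η`-regular (no isometric uniform Barlow stacking with parameters in the box `B = [47/50, 1] × [39a/50,
17a/20]` is two-way `η`-matched with `X` on the ball `B(p, 2)`) have density zero: for every `δ > 0`,
for all large `L`, at most `δ L³` of them have norm `≤ L`.  Open-problem sized: the coercive
crystallization inequality for Lennard-Jones in `ℝ³` transported to local limits, plus GSC surgery
against foam, polycrystallinity and bulk strain. -/
theorem stub_sparseIrregular :
    ∀ η r₀ : ℝ, 0 < η → 0 < r₀ → ∀ X : Set (EuclideanSpace ℝ (Fin 3)),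
      IsLocalLimitOfGroundStates lennardJones 3 X → IsHardCoreGSC lennardJones X →
      (∀ c : EuclideanSpace ℝ (Fin 3), ∃ q ∈ X, dist q c ≤ r₀) →
      ∀ δ : ℝ, 0 < δ → ∃ L₀ : ℝ, ∀ L : ℝ, L₀ ≤ L →
        ∃ F : Finset (EuclideanSpace ℝ (Fin 3)), (F.card : ℝ) ≤ δ * L ^ 3 ∧
          ∀ p ∈ X, ‖p‖ ≤ L →
            (¬ ∃ (A : EuclideanSpace ℝ (Fin 3) ≃ₗᵢ[ℝ] EuclideanSpace ℝ (Fin 3))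
                (v : EuclideanSpace ℝ (Fin 3)) (a h : ℝ) (s : ℤ → ℤ),
                (47 / 50 ≤ a ∧ a ≤ 1 ∧ 39 / 50 * a ≤ h ∧ h ≤ 17 / 20 * a) ∧ IsHaggSeq s ∧
                  BallMatch η 2 p X ((fun x => A x + v) '' barlowStacking a h s)) →
            p ∈ F := by
  sorry

/-- **Stub C — close-packed rigidity (local-to-global, pure geometry).**  For every `R > 0` there are
`R₁ ≥ R` and `η > 0` such that: if `X ⊆ ℝ³` is uniformly discrete, `c ∈ X`, and every point of `X` in
the ball `B(c, R₁)` is `η`-regular (two-way `η`-matched on its radius-`2` ball with an isometric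
uniform Barlow stacking with parameters in `B`, any Hägg word), then `X` is two-way `(1/2000)`-matched
on `B(c, R)` with ONE isometric uniform Barlow stacking with parameters in `B`.  Exact version:
coherent twin planes of a common normal form a Hägg word; non-parallel coherent planes that both meet
`B(c, R)` meet each other within `2R` of `c`, where the junction is irregular; then compactness
(`LocalMatchingCompactness`) gives `η`.  False friends: graded lattice parameters (killed by `η ≪ R⁻²`),
the four layer normals of ideal fcc (killed by `R₁ ≥ 2R + O(1)`). -/
theorem stub_closePackedRigidity :
    ∀ R : ℝ, 0 < R → ∃ R₁ : ℝ, R ≤ R₁ ∧ ∃ η : ℝ, 0 < η ∧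
      ∀ X : Set (EuclideanSpace ℝ (Fin 3)), UniformlyDiscrete X → ∀ c ∈ X,
        (∀ p ∈ X, dist p c ≤ R₁ →
          ∃ (A : EuclideanSpace ℝ (Fin 3) ≃ₗᵢ[ℝ] EuclideanSpace ℝ (Fin 3))
            (v : EuclideanSpace ℝ (Fin 3)) (a h : ℝ) (s : ℤ → ℤ),
            (47 / 50 ≤ a ∧ a ≤ 1 ∧ 39 / 50 * a ≤ h ∧ h ≤ 17 / 20 * a) ∧ IsHaggSeq s ∧
              BallMatch η 2 p X ((fun x => A x + v) '' barlowStacking a h s)) →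
        ∃ (A : EuclideanSpace ℝ (Fin 3) ≃ₗᵢ[ℝ] EuclideanSpace ℝ (Fin 3))
          (v : EuclideanSpace ℝ (Fin 3)) (a h : ℝ) (s : ℤ → ℤ),
          (47 / 50 ≤ a ∧ a ≤ 1 ∧ 39 / 50 * a ≤ h ∧ h ≤ 17 / 20 * a) ∧ IsHaggSeq s ∧
            BallMatch (1 / 2000) R c X ((fun x => A x + v) '' barlowStacking a h s) := by
  sorry

/-- **Stub P — zero-pressure box (equation of state of bulk local limits).**  In an `r₀`-dense
hard-core GSC `X ∈ 𝔏`, for every `R > 0` there is `R₂ ≥ R` such that every loose window — `X` two-way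
`(1/2000)`-matched on `B(c, R₂)`, `c ∈ X`, with an isometric uniform Barlow stacking with parameters in
the registry box `B = [47/50, 1] × [39a/50, 17a/20]` — re-matches on `B(c, R)` at tolerance `1/1000`
with parameters in the zero-pressure box `B′ = [191/200, 197/200] × [81a/100, 329a/400]`: local limits of
FREE Lennard-Jones clusters carry no bulk strain beyond `B′` (finite-`N` minimality: transport of surplus
or deficit matter to the free surface; certified shape of the Barlow energy `e(a, h)` on `B`; re-anchoring
of the stacking at the window by `BarlowStackingWindowRebase`). -/
theorem stub_zeroPressureBox :
    ∀ r₀ : ℝ, 0 < r₀ → ∀ X : Set (EuclideanSpace ℝ (Fin 3)),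
      IsLocalLimitOfGroundStates lennardJones 3 X → IsHardCoreGSC lennardJones X →
      (∀ c : EuclideanSpace ℝ (Fin 3), ∃ q ∈ X, dist q c ≤ r₀) →
      ∀ R : ℝ, 0 < R → ∃ R₂ : ℝ, R ≤ R₂ ∧ ∀ c ∈ X,
        ∀ (A : EuclideanSpace ℝ (Fin 3) ≃ₗᵢ[ℝ] EuclideanSpace ℝ (Fin 3))
          (v : EuclideanSpace ℝ (Fin 3)) (a h : ℝ) (s : ℤ → ℤ),
          (47 / 50 ≤ a ∧ a ≤ 1 ∧ 39 / 50 * a ≤ h ∧ h ≤ 17 / 20 * a) → IsHaggSeq s →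
          BallMatch (1 / 2000) R₂ c X ((fun x => A x + v) '' barlowStacking a h s) →
          ∃ (A' : EuclideanSpace ℝ (Fin 3) ≃ₗᵢ[ℝ] EuclideanSpace ℝ (Fin 3))
            (v' : EuclideanSpace ℝ (Fin 3)) (a' h' : ℝ) (s' : ℤ → ℤ),
            (191 / 200 ≤ a' ∧ a' ≤ 197 / 200 ∧ 81 / 100 * a' ≤ h' ∧ h' ≤ 329 / 400 * a') ∧
              IsHaggSeq s' ∧
              BallMatch (1 / 1000) R c X ((fun x => A' x + v') '' barlowStacking a' h' s') := by
  sorry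

/-! ## The composition (sorry-free) -/

section Composition

/-- The cubic grid of centres `sp · (k₀, k₁, k₂)`, `k : Fin 3 → Fin m`. -/
def gridCentre (sp : ℝ) {m : ℕ} (k : Fin 3 → Fin m) : EuclideanSpace ℝ (Fin 3) :=
  WithLp.toLp 2 fun i => sp * ((k i : ℕ) : ℝ)

theorem gridCentre_apply (sp : ℝ) {m : ℕ} (k : Fin 3 → Fin m) (i : Fin 3) :
    gridCentre sp k i = sp * ((k i : ℕ) : ℝ) := rfl

/-- Grid centres lie in the ball of radius `2 sp m` about the origin. -/
theorem norm_gridCentre_le {sp : ℝ} (hsp : 0 ≤ sp) {m : ℕ} (k : Fin 3 → Fin m) :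
    ‖gridCentre sp k‖ ≤ 2 * sp * m := by
  have hcoord : ∀ i, ‖gridCentre sp k i‖ ^ 2 ≤ (sp * m) ^ 2 := by
    intro i
    rw [gridCentre_apply, Real.norm_eq_abs, abs_of_nonneg (by positivity)]
    have hk : ((k i : ℕ) : ℝ) ≤ m := by exact_mod_cast (k i).is_lt.le
    have : sp * ((k i : ℕ) : ℝ) ≤ sp * m := mul_le_mul_of_nonneg_left hk hsp
    exact pow_le_pow_left₀ (by positivity) this 2
  have hsq : ‖gridCentre sp k‖ ^ 2 ≤ (2 * sp * m) ^ 2 := by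
    rw [EuclideanSpace.norm_sq_eq, Fin.sum_univ_three]
    nlinarith [hcoord 0, hcoord 1, hcoord 2, sq_nonneg (sp * m)]
  exact (pow_le_pow_iff_left₀ (norm_nonneg _) (by positivity) two_ne_zero).1 hsq

/-- Distinct grid centres are at distance `≥ sp`. -/
theorem le_dist_gridCentre {sp : ℝ} (hsp : 0 ≤ sp) {m : ℕ} {k k' : Fin 3 → Fin m}
    (hkk' : k ≠ k') : sp ≤ dist (gridCentre sp k) (gridCentre sp k') := by
  obtain ⟨i, hi⟩ : ∃ i, k i ≠ k' i := Function.ne_iff.1 hkk'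
  have hne : ((k i : ℕ) : ℤ) ≠ ((k' i : ℕ) : ℤ) := by
    intro h
    exact hi (Fin.ext (by exact_mod_cast h))
  have hone : (1 : ℝ) ≤ |((k i : ℕ) : ℝ) - ((k' i : ℕ) : ℝ)| := by
    have h1 : (1 : ℤ) ≤ |((k i : ℕ) : ℤ) - ((k' i : ℕ) : ℤ)| := Int.one_le_abs (sub_ne_zero.2 hne)
    have h2 : ((1 : ℤ) : ℝ) ≤ ((|((k i : ℕ) : ℤ) - ((k' i : ℕ) : ℤ)| : ℤ) : ℝ) := by exact_mod_cast h1
    simpa [Int.cast_abs, Int.cast_sub] using h2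
  calc sp = sp * 1 := (mul_one sp).symm
    _ ≤ sp * |((k i : ℕ) : ℝ) - ((k' i : ℕ) : ℝ)| := mul_le_mul_of_nonneg_left hone hsp
    _ = ‖(gridCentre sp k - gridCentre sp k') i‖ := by
        rw [PiLp.sub_apply, gridCentre_apply, gridCentre_apply, ← mul_sub, Real.norm_eq_abs,
          abs_mul, abs_of_nonneg hsp]
    _ ≤ ‖gridCentre sp k - gridCentre sp k'‖ := PiLp.norm_apply_le _ i
    _ = dist (gridCentre sp k) (gridCentre sp k') := (dist_eq_norm _ _).symm

/-- **Composition.**  The three stub statements imply the crux, stated in `Literature` vocabulary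
(`IsLocalLimitOfGroundStates`, `IsHardCoreGSC`, `BallMatch` unfold by `Iff.rfl` to the clauses inlined
in the route decl, so `LayeredWindows_of` below is a mere re-typing).  Proof: fix `X`, `r₀`, `R`; P gives
`R₂ ≥ R`; C at radius `R₂` gives `R₁ ≥ R₂` and `η`; S with `δ = 1 / (128 sp³)`, `sp = 2(R₁ + r₀) + 2`,
gives `L₀`; on the grid of `m³` centres (`m ≥ max 1 L₀`) the balls of radius `R₁ + r₀` are disjoint and
lie in `‖·‖ ≤ L = 3 sp m + (R₁ + r₀)`, so if each contained an irregular particle there would be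
`m³ ≤ δ L³ ≤ m³ / 2` of them; a clean ball contains a particle `q` within `r₀` of its centre, every
particle of `B(q, R₁)` is regular, C gives a loose window of radius `R₂` at `q`, and P the `B′`-window
of radius `R` at `q ∈ X`. -/
theorem layeredWindows_of_stubs
    (hS : ∀ η r₀ : ℝ, 0 < η → 0 < r₀ → ∀ X : Set (EuclideanSpace ℝ (Fin 3)),
      IsLocalLimitOfGroundStates lennardJones 3 X → IsHardCoreGSC lennardJones X →
      (∀ c : EuclideanSpace ℝ (Fin 3), ∃ q ∈ X, dist q c ≤ r₀) →
      ∀ δ : ℝ, 0 < δ → ∃ L₀ : ℝ, ∀ L : ℝ, L₀ ≤ L →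
        ∃ F : Finset (EuclideanSpace ℝ (Fin 3)), (F.card : ℝ) ≤ δ * L ^ 3 ∧
          ∀ p ∈ X, ‖p‖ ≤ L →
            (¬ ∃ (A : EuclideanSpace ℝ (Fin 3) ≃ₗᵢ[ℝ] EuclideanSpace ℝ (Fin 3))
                (v : EuclideanSpace ℝ (Fin 3)) (a h : ℝ) (s : ℤ → ℤ),
                (47 / 50 ≤ a ∧ a ≤ 1 ∧ 39 / 50 * a ≤ h ∧ h ≤ 17 / 20 * a) ∧ IsHaggSeq s ∧
                  BallMatch η 2 p X ((fun x => A x + v) '' barlowStacking a h s)) →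
            p ∈ F)
    (hC : ∀ R : ℝ, 0 < R → ∃ R₁ : ℝ, R ≤ R₁ ∧ ∃ η : ℝ, 0 < η ∧
      ∀ X : Set (EuclideanSpace ℝ (Fin 3)), UniformlyDiscrete X → ∀ c ∈ X,
        (∀ p ∈ X, dist p c ≤ R₁ →
          ∃ (A : EuclideanSpace ℝ (Fin 3) ≃ₗᵢ[ℝ] EuclideanSpace ℝ (Fin 3))
            (v : EuclideanSpace ℝ (Fin 3)) (a h : ℝ) (s : ℤ → ℤ),
            (47 / 50 ≤ a ∧ a ≤ 1 ∧ 39 / 50 * a ≤ h ∧ h ≤ 17 / 20 * a) ∧ IsHaggSeq s ∧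
              BallMatch η 2 p X ((fun x => A x + v) '' barlowStacking a h s)) →
        ∃ (A : EuclideanSpace ℝ (Fin 3) ≃ₗᵢ[ℝ] EuclideanSpace ℝ (Fin 3))
          (v : EuclideanSpace ℝ (Fin 3)) (a h : ℝ) (s : ℤ → ℤ),
          (47 / 50 ≤ a ∧ a ≤ 1 ∧ 39 / 50 * a ≤ h ∧ h ≤ 17 / 20 * a) ∧ IsHaggSeq s ∧
            BallMatch (1 / 2000) R c X ((fun x => A x + v) '' barlowStacking a h s))
    (hP : ∀ r₀ : ℝ, 0 < r₀ → ∀ X : Set (EuclideanSpace ℝ (Fin 3)),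
      IsLocalLimitOfGroundStates lennardJones 3 X → IsHardCoreGSC lennardJones X →
      (∀ c : EuclideanSpace ℝ (Fin 3), ∃ q ∈ X, dist q c ≤ r₀) →
      ∀ R : ℝ, 0 < R → ∃ R₂ : ℝ, R ≤ R₂ ∧ ∀ c ∈ X,
        ∀ (A : EuclideanSpace ℝ (Fin 3) ≃ₗᵢ[ℝ] EuclideanSpace ℝ (Fin 3))
          (v : EuclideanSpace ℝ (Fin 3)) (a h : ℝ) (s : ℤ → ℤ),
          (47 / 50 ≤ a ∧ a ≤ 1 ∧ 39 / 50 * a ≤ h ∧ h ≤ 17 / 20 * a) → IsHaggSeq s →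
          BallMatch (1 / 2000) R₂ c X ((fun x => A x + v) '' barlowStacking a h s) →
          ∃ (A' : EuclideanSpace ℝ (Fin 3) ≃ₗᵢ[ℝ] EuclideanSpace ℝ (Fin 3))
            (v' : EuclideanSpace ℝ (Fin 3)) (a' h' : ℝ) (s' : ℤ → ℤ),
            (191 / 200 ≤ a' ∧ a' ≤ 197 / 200 ∧ 81 / 100 * a' ≤ h' ∧ h' ≤ 329 / 400 * a') ∧
              IsHaggSeq s' ∧
              BallMatch (1 / 1000) R c X ((fun x => A' x + v') '' barlowStacking a' h' s')) :
    ∀ X : Set (EuclideanSpace ℝ (Fin 3)),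
      IsLocalLimitOfGroundStates lennardJones 3 X → IsHardCoreGSC lennardJones X →
      ∀ r₀ : ℝ, 0 < r₀ → (∀ c : EuclideanSpace ℝ (Fin 3), ∃ q ∈ X, dist q c ≤ r₀) →
      ∀ R : ℝ, 0 < R → ∃ c ∈ X,
        ∃ (A : EuclideanSpace ℝ (Fin 3) ≃ₗᵢ[ℝ] EuclideanSpace ℝ (Fin 3))
          (v : EuclideanSpace ℝ (Fin 3)) (a h : ℝ) (s : ℤ → ℤ),
          (191 / 200 ≤ a ∧ a ≤ 197 / 200 ∧ 81 / 100 * a ≤ h ∧ h ≤ 329 / 400 * a) ∧ IsHaggSeq s ∧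
            BallMatch (1 / 1000) R c X ((fun x => A x + v) '' barlowStacking a h s) := by
  intro X hL hG r₀ hr₀ hdense R hR
  -- P: the radius `R₂ ≥ R` of a loose window that re-matches into `B′` on radius `R`
  obtain ⟨R₂, hRR₂, hP'⟩ := hP r₀ hr₀ X hL hG hdense R hR
  have hR₂ : 0 < R₂ := hR.trans_le hRR₂
  -- C at radius `R₂`: hypothesis radius `R₁ ≥ R₂` and local tolerance `η`
  obtain ⟨R₁, hR₂R₁, η, hη, hC'⟩ := hC R₂ hR₂
  have hR₁ : 0 < R₁ := hR₂.trans_le hR₂R₁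
  -- scales: ball radius `R' = R₁ + r₀`, grid spacing `sp = 2R' + 2`, density `δ = 1 / (128 sp³)`
  set R' : ℝ := R₁ + r₀ with hR'def
  have hR' : 0 < R' := by positivity
  set sp : ℝ := 2 * R' + 2 with hspdef
  have hsp : 0 < sp := by positivity
  set δ : ℝ := 1 / (128 * sp ^ 3) with hδdef
  have hδ : 0 < δ := by positivity
  obtain ⟨L₀, hL₀⟩ := hS η r₀ hη hr₀ X hL hG hdense δ hδ
  -- grid size `m ≥ max 1 L₀`
  obtain ⟨m, hm1, hmL⟩ : ∃ m : ℕ, 1 ≤ m ∧ L₀ ≤ m := by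
    refine ⟨max 1 ⌈L₀⌉₊, le_max_left _ _, (Nat.le_ceil L₀).trans ?_⟩
    exact_mod_cast le_max_right 1 ⌈L₀⌉₊
  have hm : (1 : ℝ) ≤ m := by exact_mod_cast hm1
  set L : ℝ := 3 * sp * m + R' with hLdef
  have hL₀L : L₀ ≤ L := by
    have h1 : (m : ℝ) ≤ 3 * sp * m := by nlinarith
    have h2 : 3 * sp * m ≤ L := by rw [hLdef]; linarith
    exact hmL.trans (h1.trans h2)
  obtain ⟨F, hFcard, hF⟩ := hL₀ L hL₀L
  -- some grid ball `B(gridCentre sp k, R')` contains no irregular particle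
  have hclean : ∃ k : Fin 3 → Fin m, ∀ p ∈ X, dist p (gridCentre sp k) ≤ R' →
      ∃ (A : EuclideanSpace ℝ (Fin 3) ≃ₗᵢ[ℝ] EuclideanSpace ℝ (Fin 3))
        (v : EuclideanSpace ℝ (Fin 3)) (a h : ℝ) (s : ℤ → ℤ),
        (47 / 50 ≤ a ∧ a ≤ 1 ∧ 39 / 50 * a ≤ h ∧ h ≤ 17 / 20 * a) ∧ IsHaggSeq s ∧
          BallMatch η 2 p X ((fun x => A x + v) '' barlowStacking a h s) := by
    by_contra hno
    have hno' : ∀ k : Fin 3 → Fin m, ∃ p, p ∈ X ∧ dist p (gridCentre sp k) ≤ R' ∧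
        ¬ ∃ (A : EuclideanSpace ℝ (Fin 3) ≃ₗᵢ[ℝ] EuclideanSpace ℝ (Fin 3))
          (v : EuclideanSpace ℝ (Fin 3)) (a h : ℝ) (s : ℤ → ℤ),
          (47 / 50 ≤ a ∧ a ≤ 1 ∧ 39 / 50 * a ≤ h ∧ h ≤ 17 / 20 * a) ∧ IsHaggSeq s ∧
            BallMatch η 2 p X ((fun x => A x + v) '' barlowStacking a h s) := by
      intro k
      by_contra hk
      refine hno ⟨k, fun p hp hpk => ?_⟩
      by_contra hreg
      exact hk ⟨p, hp, hpk, hreg⟩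
    choose d hdX hdk hdirr using hno'
    -- every `d k` is an irregular particle of norm `≤ L`, hence in `F`
    have hdF : ∀ k, d k ∈ F := by
      intro k
      refine hF (d k) (hdX k) ?_ (hdirr k)
      have h1 : ‖d k‖ ≤ ‖gridCentre sp k‖ + dist (d k) (gridCentre sp k) := by
        have := norm_le_norm_add_norm_sub (gridCentre sp k) (d k)
        -- ‖d k‖ ≤ ‖c‖ + ‖d k - c‖
        calc ‖d k‖ = ‖gridCentre sp k + (d k - gridCentre sp k)‖ := by rw [add_sub_cancel]
          _ ≤ ‖gridCentre sp k‖ + ‖d k - gridCentre sp k‖ := norm_add_le _ _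
          _ = ‖gridCentre sp k‖ + dist (d k) (gridCentre sp k) := by rw [dist_eq_norm]
      have h2 := norm_gridCentre_le hsp.le k
      have h3 : 2 * sp * m + R' ≤ L := by rw [hLdef]; nlinarith
      linarith [hdk k]
    -- `d` is injective: distinct grid balls are `sp - 2R' = 2` apart
    have hinj : Function.Injective d := by
      intro k k' hkk'
      by_contra hne
      have hfar := le_dist_gridCentre hsp.le (m := m) hne
      have htri : dist (gridCentre sp k) (gridCentre sp k') ≤
          dist (gridCentre sp k) (d k) + dist (d k) (gridCentre sp k') := dist_triangle _ _ _
      rw [hkk'] at htri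
      have h1 := hdk k'
      have h2 : dist (gridCentre sp k) (d k') ≤ R' := by rw [dist_comm, ← hkk']; exact hdk k
      have : sp ≤ 2 * R' := by linarith
      rw [hspdef] at this
      linarith
    -- counting: `m³ ≤ #F ≤ δ L³ ≤ m³ / 2`
    have hcard : (m : ℝ) ^ 3 ≤ F.card := by
      have hle : Fintype.card (Fin 3 → Fin m) ≤ Fintype.card F :=
        Fintype.card_le_of_injective (fun k => (⟨d k, hdF k⟩ : F))
          (fun k k' h => hinj (congrArg Subtype.val h))
      have h' : m ^ 3 ≤ F.card := by simpa [Fintype.card_fun, Fintype.card_fin] using hle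
      exact_mod_cast h'
    have hLle : L ≤ 4 * sp * m := by
      have : R' ≤ sp * m := by nlinarith
      rw [hLdef]; linarith
    have hL0 : 0 ≤ L := by rw [hLdef]; positivity
    have hδL : δ * L ^ 3 ≤ δ * (4 * sp * m) ^ 3 := by gcongr
    have hval : δ * (4 * sp * m) ^ 3 = (m : ℝ) ^ 3 / 2 := by
      rw [hδdef]; field_simp; ring
    have hm3 : (0 : ℝ) < (m : ℝ) ^ 3 := by positivity
    linarith
  obtain ⟨k, hk⟩ := hclean
  -- anchor the clean ball at a particle `q ∈ X` within `r₀` of its centre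
  obtain ⟨q, hqX, hqk⟩ := hdense (gridCentre sp k)
  have hreg : ∀ p ∈ X, dist p q ≤ R₁ →
      ∃ (A : EuclideanSpace ℝ (Fin 3) ≃ₗᵢ[ℝ] EuclideanSpace ℝ (Fin 3))
        (v : EuclideanSpace ℝ (Fin 3)) (a h : ℝ) (s : ℤ → ℤ),
        (47 / 50 ≤ a ∧ a ≤ 1 ∧ 39 / 50 * a ≤ h ∧ h ≤ 17 / 20 * a) ∧ IsHaggSeq s ∧
          BallMatch η 2 p X ((fun x => A x + v) '' barlowStacking a h s) := by
    intro p hp hpq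
    refine hk p hp ?_
    calc dist p (gridCentre sp k) ≤ dist p q + dist q (gridCentre sp k) := dist_triangle _ _ _
      _ ≤ R₁ + r₀ := add_le_add hpq hqk
  -- `X ∈ 𝔏` is uniformly discrete (minimal distance of Lennard-Jones ground states, proved)
  have hUD : UniformlyDiscrete X := hL.uniformlyDiscrete_lennardJones LennardJonesMinimalDistance_holds
  -- C: a loose window of radius `R₂` at `q`; P: the `B′`-window of radius `R` at `q`
  obtain ⟨A, v, a, h, s, hbox, hs, hmatch⟩ := hC' X hUD q hqX hreg
  obtain ⟨A', v', a', h', s', hbox', hs', hmatch'⟩ := hP' q hqX A v a h s hbox hs hmatch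
  exact ⟨q, hqX, A', v', a', h', s', hbox', hs', hmatch'⟩

end Composition

/-- **The crux BY NAME from the three registered stubs.**  The kernel checks here that the composition
reaches the route decl `GscTwinLoopSurgery.LayeredWindows` (its inlined clauses are the `Iff.rfl`
unfoldings of `IsLocalLimitOfGroundStates`, `IsHardCoreGSC`, `BallMatch`); the only `sorry`s in its cone
are `stub_sparseIrregular`, `stub_closePackedRigidity`, `stub_zeroPressureBox`. -/
theorem LayeredWindows_of :
    Summit.AtomisticToContinuum.Crystallization.Theses.GscTwinLoopSurgery.LayeredWindows :=
  layeredWindows_of_stubs stub_sparseIrregular stub_closePackedRigidity stub_zeroPressureBox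

end Summit.AtomisticToContinuum.Crystallization.Cruxes.LayeredWindows.Birth
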